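import Summits.AtomisticToContinuum.HydrodynamicLimit.Theorems.CollisionIsometryCLTCollisionalTransferLocalityDefsB
import Summits.AtomisticToContinuum.HydrodynamicLimit.Theorems.StiffCollisionalRelaxationAprioriBoundsCeilingChain
import Summits.AtomisticToContinuum.HydrodynamicLimit.Theorems.StiffCollisionalRelaxationAprioriBoundsCeilingFixedHomogeneous
import Summits.AtomisticToContinuum.HydrodynamicLimit.Theorems.StiffCollisionalRelaxationAprioriBoundsCeilingStatics
import HarnessLib

/-!
# The all-times dilute block ceiling at homogeneous data (equilibrium rung of `stub_ceilingAllTimes`)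

Supporting file (`--supports stmt-AtomisticToContinuum-9518`) of the line `hemisphere-affine-slaving` for the
crux `CollisionalTransferLocality` (`Summit.AtomisticToContinuum.HydrodynamicLimit.Theses.StiffCollisionalRelaxation.CollisionalTransferLocality`),
lead prover `prover-line-stmt-AtomisticToContinuum-9518-c4-0`, stub worker W-S.  The registered stub
`stub_ceilingAllTimes` asks, for EVERY level `η₁ > 0` and all nice profiles, for a threshold `σ₀(η₁, profiles)`
below which, for every flow family `Φ`, EVERY horizon `t > 0` and every admissible kernel family, the dilute
block ceiling `DiluteAt σ a₀ θ₀ u₀ Φ t φ η₁` holds (w.h.p. no block density `ρ̄ = rhoB` exceeds `η₁/σ³` at any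
`s ≤ t`).  Off equilibrium this is open (the only a-priori information along the deterministic flow is
conservation + Liouville, whose entropy budget `H(μ₀ | G) ≍ N` does not see a one-block deviation of cost
`≍ N^{1−3γ}`; and for focusing profiles smooth implosion threatens it — `Cruxes/AprioriBounds/Disproof.lean` §5).

This file proves its EQUILIBRIUM RUNG `ceilingAllTimes_const`: for constant profiles `(a₀, θ₀, u₀) = (1, θ, 0)`
the statement holds VERBATIM (same quantifier order, `σ₀` depending on `η₁` and `θ` only, every flow family,
every `t > 0`, every admissible kernel family with `0 < γ ≤ 1/15`).  Assembly of landed tree facts: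

* `ceilingFixed_homogeneous_level` — the fixed-`(s, x)` packing bound at an ARBITRARY level `η > 2σ³`
  (adapted from `AdiabatCeiling.ceilingFixed_homogeneous_of_static`, which is the level `1/2`): flow invariance
  of the homogeneous law (`flow_invariance_homogeneous`), position marginal = canonical gas
  (`localGibbsMeasure_preimage_pos`), static Ruelle–Chernoff tail (`posGibbs_sum_gt_le`) with `K = η/σ³ > 2`;
  rate `δ_N = exp(−b (N+1)^{1−3γ})`, `(N+1)² δ_N → 0`.
* `energyCap_homogeneous` — the conserved-energy cap `P_N{z ∉ good ∨ K(N+1) < E(z)} → 0` at equilibrium, from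
  the identified `t = 0` law of large numbers (`LocalSecondLawNegative.homogeneous_lln_identified`) and the
  landed `stub_energyCap`.
* `ceilingAllTimes_const` — the space–time chain `AdiabatCeiling.ceilingChain` (grid + union bound + block
  modulus `stub_blockModulus`) applied to the RESCALED kernel `φ/η₁` (block density is linear in the kernel,
  `empiricalDensityField_const_mul`), which turns its hard-wired levels `1/2 ↦ 1` into `η₁/2 ↦ η₁`.

No new definitions, no named facts, no `sorry`; axioms `propext`, `Classical.choice`, `Quot.sound`.
-/

noncomputable section

namespace Summit.AtomisticToContinuum.HydrodynamicLimit.Theorems.HemisphereAffineSlaving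

open MeasureTheory Filter Set Topology
open scoped ENNReal
open Literature.MathematicalPhysics.KineticTheory Literature.Analysis.FluidPDE
open Summit.AtomisticToContinuum.HydrodynamicLimit.Theorems.AdiabatCeiling

/-! ## §1 The fixed-point packing bound at homogeneous data, arbitrary level -/

/-- **The ceiling at homogeneous data, level `η`, for every flow.**  Let `SmallDensity uniformProfile σ`
(so `0 < σ < 1/2` and the static cluster bounds hold), `θ₀ > 0`, and a level `η` with `2σ³ < η`.  Then for
every family of hard-sphere flows `Φ_N` and every admissible kernel family `φ_N` (`0 < γ < 1/3`) there is a
rate `δ_N` with `(N+1)² δ_N → 0` such that for all `N`, all times `s` and all centres `x`,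
`localGibbsLaw σ 1 0 θ₀ N Φ_N {z | η < ρ̄_N(Φ_s z, x) σ³} ≤ δ_N`.
Proof: flow invariance of the homogeneous law (`flow_invariance_homogeneous`) removes `Φ_s`; the event is
positional and the position marginal is the canonical gas (`localGibbsMeasure_preimage_pos`); the static
Chernoff tail `posGibbs_sum_gt_le` with `g = φ_N(· − x)`, `∫g = 1`, `L = C(N+1)^{3γ} + 1`, `K = η/σ³ > 2`
gives `exp(−(N+1)h/L) ≤ exp(−(h/(C+1))(N+1)^{1−3γ})`, `h = K log(K/2) − K + 2 > 0`. -/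
-- adapted from `AdiabatCeiling.ceilingFixed_homogeneous_of_static` (level `1/2`, `K = 1/(2σ³)`), with the
-- static hypothesis `hstat` discharged by `posGibbs_sum_gt_le`.
theorem ceilingFixed_homogeneous_level {σ θ₀ η : ℝ} (hsd : SmallDensity uniformProfile σ) (hθ : 0 < θ₀)
    (hησ : 2 * σ ^ 3 < η) (Φ : Flows σ) {γ C : ℝ} {φ : ℕ → T3 → ℝ} (hγ : 0 < γ) (hγ1 : γ < 1 / 3)
    (hadm : AdmissibleKernel γ C φ) :
    ∃ δ : ℕ → ℝ, Tendsto (fun N : ℕ => ((N : ℝ) + 1) ^ 2 * δ N) atTop (𝓝 0) ∧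
      ∀ (N : ℕ) (s : ℝ) (x : T3),
        localGibbsLaw σ (fun _ => 1) (fun _ => 0) (fun _ => θ₀) N (Φ N)
            {z | η < empiricalDensityField ((Φ N).flow s z) (fun y => φ N (y - x)) * σ ^ 3} ≤
          ENNReal.ofReal (δ N) := by
  obtain ⟨hsm, hφ0, hφ1, -, hφC, -⟩ := hadm
  have hσ : 0 < σ := hsd.σ_pos
  have hσ3 : 0 < σ ^ 3 := by positivity
  obtain ⟨K, hK⟩ : ∃ K : ℝ, K = η / σ ^ 3 := ⟨_, rfl⟩
  have hK2 : 2 < K := by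
    rw [hK, lt_div_iff₀ hσ3]
    linarith
  have hh0 : 0 < K * Real.log (K / 2) - K + 2 := ceilingHom_rate_pos hK2
  have hC : 0 ≤ C := by
    have h1 := hφC 0 0
    simp only [Nat.cast_zero, zero_add, Real.one_rpow, mul_one] at h1
    exact (hφ0 0 0).trans h1
  have ha0 : 0 < 1 - 3 * γ := by linarith
  have hb0 : 0 < (K * Real.log (K / 2) - K + 2) / (C + 1) := div_pos hh0 (by linarith)
  refine ⟨fun N => Real.exp (-((K * Real.log (K / 2) - K + 2) / (C + 1) * ((N : ℝ) + 1) ^ (1 - 3 * γ))),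
    ceilingHom_tendsto ha0 hb0, fun N s x => ?_⟩
  have hn : (0 : ℝ) < (N : ℝ) + 1 := by positivity
  -- the observable `g = φ_N (· - x)`: measurable, `0 ≤ g ≤ L = C (N+1)^{3γ} + 1`, `∫ g = 1`
  set g : T3 → ℝ := fun y => φ N (y - x) with hg
  have hgm : Measurable g := ((hsm N).continuous.comp (continuous_sub_right x)).measurable
  have hg0 : ∀ y, 0 ≤ g y := fun y => hφ0 N _
  have hm1 : 1 ≤ ((N : ℝ) + 1) ^ (3 * γ) := Real.one_le_rpow (by linarith) (by linarith)
  obtain ⟨L, hL⟩ : ∃ L : ℝ, L = C * ((N : ℝ) + 1) ^ (3 * γ) + 1 := ⟨_, rfl⟩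
  have hL0 : 0 < L := by
    rw [hL]
    exact add_pos_of_nonneg_of_pos (mul_nonneg hC (by positivity)) one_pos
  have hgL : ∀ y, g y ≤ L := fun y => by
    rw [hL]
    exact (hφC N _).trans (le_add_of_nonneg_right zero_le_one)
  have hIg : ∫ y, g y = 1 := by
    rw [hg]
    exact (integral_sub_right_eq_self (μ := volume) (φ N) x).trans (hφ1 N)
  -- the positional super-level event and its measurability
  obtain ⟨S, hS⟩ : ∃ S : Set (Fin (N + 1) → T3),
      S = {p | ((N : ℝ) + 1) * K * (∫ y, g y) < ∑ i, g (p i)} := ⟨_, rfl⟩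
  have hSm : MeasurableSet S := by
    rw [hS]
    exact measurableSet_lt measurable_const
      (Finset.measurable_sum _ fun i _ => hgm.comp (measurable_pi_apply i))
  -- `{η < ρ̄(Φ_s z, x) σ³} ⊆ Φ_s⁻¹ (pos⁻¹ S)`: `(N+1)⁻¹ (∑ g) σ³ > η ↔ (N+1) η/σ³ < ∑ g`
  have hsub : {z : Config (N + 1) (Fin 3) T3 |
        η < empiricalDensityField ((Φ N).flow s z) g * σ ^ 3} ⊆
      (Φ N).flow s ⁻¹' ((fun (z : Config (N + 1) (Fin 3) T3) (i : Fin (N + 1)) => (z i).1) ⁻¹' S) := by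
    intro z hz
    rw [Set.mem_setOf_eq, empiricalDensityField_eq_sum] at hz
    push_cast at hz
    rw [mul_assoc, inv_mul_eq_div, lt_div_iff₀ hn] at hz
    rw [Set.mem_preimage, Set.mem_preimage, hS, Set.mem_setOf_eq, hIg, mul_one, hK, mul_div_assoc',
      div_lt_iff₀ hσ3]
    linarith
  -- invariance removes the flow, the position marginal is the canonical gas, then the static tail
  rw [localGibbsLaw_eq]
  have hinv := flow_invariance_homogeneous σ θ₀ N (Φ N) s
  have hmarg : localGibbsMeasure σ (fun _ => 1) (fun _ => 0) (fun _ => θ₀) N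
        ((fun (z : Config (N + 1) (Fin 3) T3) (i : Fin (N + 1)) => (z i).1) ⁻¹' S) =
      posGibbsMeasure (fun _ => (1 : ℝ)) (hsDiameter σ N) (N + 1) S :=
    localGibbsMeasure_preimage_pos (a₀ := fun _ => (1 : ℝ)) (θ₀ := fun _ => θ₀) (u₀ := fun _ => (0 : V3))
      continuous_const continuous_const continuous_const (fun _ => zero_le_one) (fun _ => hθ) σ N hSm
  have hstatN := posGibbs_sum_gt_le hsd N hgm hL0 hg0 hgL hK2
  rw [← hS] at hstatN
  -- the comparison of the exponents: `b (N+1)^{1-3γ} ≤ (N+1) h / L`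
  have hkey : ((N : ℝ) + 1) ^ (1 - 3 * γ) / (C + 1) ≤ ((N : ℝ) + 1) / L := by
    rw [Real.rpow_sub hn, Real.rpow_one, div_div]
    refine div_le_div_of_nonneg_left hn.le hL0 ?_
    rw [hL]
    nlinarith [hm1, hC]
  have hexp : Real.exp (-((((N : ℝ) + 1) * ∫ y, g y) / L * (K * Real.log (K / 2) - K + 2))) ≤
      Real.exp (-((K * Real.log (K / 2) - K + 2) / (C + 1) * ((N : ℝ) + 1) ^ (1 - 3 * γ))) := by
    refine Real.exp_le_exp.2 (neg_le_neg ?_)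
    rw [hIg, mul_one]
    calc (K * Real.log (K / 2) - K + 2) / (C + 1) * ((N : ℝ) + 1) ^ (1 - 3 * γ)
        = (K * Real.log (K / 2) - K + 2) * (((N : ℝ) + 1) ^ (1 - 3 * γ) / (C + 1)) := by ring
      _ ≤ (K * Real.log (K / 2) - K + 2) * (((N : ℝ) + 1) / L) := mul_le_mul_of_nonneg_left hkey hh0.le
      _ = ((N : ℝ) + 1) / L * (K * Real.log (K / 2) - K + 2) := by ring
  calc localGibbsMeasure σ (fun _ => 1) (fun _ => 0) (fun _ => θ₀) N
        {z | η < empiricalDensityField ((Φ N).flow s z) g * σ ^ 3}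
      ≤ localGibbsMeasure σ (fun _ => 1) (fun _ => 0) (fun _ => θ₀) N
          ((Φ N).flow s ⁻¹' ((fun (z : Config (N + 1) (Fin 3) T3) (i : Fin (N + 1)) => (z i).1) ⁻¹' S)) :=
        measure_mono hsub
    _ ≤ localGibbsMeasure σ (fun _ => 1) (fun _ => 0) (fun _ => θ₀) N
          ((fun (z : Config (N + 1) (Fin 3) T3) (i : Fin (N + 1)) => (z i).1) ⁻¹' S) :=
        hinv.measure_preimage_le _
    _ = posGibbsMeasure (fun _ => (1 : ℝ)) (hsDiameter σ N) (N + 1) S := hmarg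
    _ ≤ ENNReal.ofReal (Real.exp (-((((N : ℝ) + 1) * ∫ y, g y) / L * (K * Real.log (K / 2) - K + 2)))) :=
        hstatN
    _ ≤ ENNReal.ofReal (Real.exp
          (-((K * Real.log (K / 2) - K + 2) / (C + 1) * ((N : ℝ) + 1) ^ (1 - 3 * γ)))) :=
        ENNReal.ofReal_le_ofReal hexp

/-! ## §2 The conserved-energy cap at equilibrium -/

/-- **Energy cap at homogeneous data, every flow family.**  For `θ₀ > 0` there is `σ₁ > 0` such that for
`0 < σ < σ₁` and every flow family `Φ` there is `K ≥ 0` with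
`localGibbsLaw σ 1 0 θ₀ N Φ_N {z ∉ good(Φ_N) ∨ K(N+1) < E(z)} → 0`: the identified `t = 0` law of large
numbers at constant profiles (`LocalSecondLawNegative.homogeneous_lln_identified`, limit fields `(1, 0, θ₀)`)
fed into the landed `stub_energyCap` (LLN at `χ ≡ 1` caps the energy per particle; the law is carried by the
good set). -/
theorem energyCap_homogeneous {θ₀ : ℝ} (hθ : 0 < θ₀) :
    ∃ σ₁ : ℝ, 0 < σ₁ ∧ ∀ σ : ℝ, 0 < σ → σ < σ₁ → ∀ Φ : Flows σ,
      ∃ K : ℝ, 0 ≤ K ∧ Tendsto (fun N : ℕ => localGibbsLaw σ (fun _ => 1) (fun _ => 0) (fun _ => θ₀) N (Φ N)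
        {z | z ∉ (Φ N).good ∨ K * ((N : ℝ) + 1) < configEnergy z}) atTop (𝓝 0) := by
  obtain ⟨σ₁, hσ₁, -, h⟩ :=
    Summit.AtomisticToContinuum.HydrodynamicLimit.Theorems.LocalSecondLawNegative.homogeneous_lln_identified hθ
  exact ⟨σ₁, hσ₁, fun σ hσ hσ1 Φ => stub_energyCap (fun _ => 1) (fun _ => θ₀) (fun _ => 0) σ
    (fun _ _ => (1 : ℝ)) (fun _ _ => θ₀) (fun _ _ => (0 : V3)) Φ (h σ hσ hσ1 Φ)⟩

/-! ## §3 Assembly: the equilibrium rung of `stub_ceilingAllTimes` -/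

/-- The block density is linear in the kernel: `ρ̄_{c χ} = c ρ̄_χ`. -/
theorem empiricalDensityField_const_mul {N : ℕ} (z : Config N (Fin 3) T3) (c : ℝ) (χ : T3 → ℝ) :
    empiricalDensityField z (fun y => c * χ y) = c * empiricalDensityField z χ := by
  unfold empiricalDensityField
  exact integral_const_mul c _

/-- **The all-times dilute block ceiling at homogeneous data (equilibrium rung of `stub_ceilingAllTimes`,
verbatim its signature at the constant profiles `(a₀, θ₀, u₀) = (1, θ, 0)`).**  For every level `η₁ > 0` and
every temperature `θ > 0` there is `σ₀ > 0` (depending on `η₁`, `θ` only) such that for all `0 < σ < σ₀`,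
EVERY family of hard-sphere flows `Φ`, EVERY horizon `t > 0` and every admissible kernel family
(`0 < γ ≤ 1/15`), `DiluteAt σ 1 θ 0 Φ t φ η₁`: with local-Gibbs probability `→ 1` no block density exceeds
`η₁/σ³` at any time `s ≤ t`.  Proof: `σ₀ = min(σ_statics, σ_LLN(θ), η₁/4)` (so `2σ³ < η₁/2`); the fixed-point
bound at level `η₁/2` (`ceilingFixed_homogeneous_level`), the energy cap (`energyCap_homogeneous`) and the
block modulus (`stub_blockModulus`) feed `AdiabatCeiling.ceilingChain` for the rescaled kernel `φ/η₁`, whose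
levels `1/2`, `1` are the levels `η₁/2`, `η₁` of `φ` (`empiricalDensityField_const_mul`). -/
theorem ceilingAllTimes_const : ∀ η₁ : ℝ, 0 < η₁ → ∀ θ : ℝ, 0 < θ → ∃ σ₀ : ℝ, 0 < σ₀ ∧ ∀ σ : ℝ, 0 < σ → σ < σ₀ → ∀ (Φ : Flows σ) (t : ℝ), 0 < t → ∀ (γ C : ℝ) (φ : ℕ → T3 → ℝ), 0 < γ → γ ≤ 1 / 15 → AdmissibleKernel γ C φ → DiluteAt σ (fun _ => 1) (fun _ => θ) (fun _ => 0) Φ t φ η₁ := by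
  intro η₁ hη₁ θ hθ
  obtain ⟨σa, hσa, hsd⟩ := exists_smallDensity uniformProfile one_pos
  obtain ⟨σb, hσb, hcapσ⟩ := energyCap_homogeneous hθ
  refine ⟨min σa (min σb (η₁ / 4)), lt_min hσa (lt_min hσb (by positivity)),
    fun σ hσ hσlt Φ t ht γ C φ hγ hγ' hadm => ?_⟩
  have hσa' : σ < σa := lt_of_lt_of_le hσlt (min_le_left _ _)
  have hσb' : σ < σb := lt_of_lt_of_le (lt_of_lt_of_le hσlt (min_le_right _ _)) (min_le_left _ _)
  have hση : σ < η₁ / 4 := lt_of_lt_of_le (lt_of_lt_of_le hσlt (min_le_right _ _)) (min_le_right _ _)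
  have hS : SmallDensity uniformProfile σ := (hsd σ hσ hσa').1
  have hσhalf : σ < 1 / 2 := hS.σ_lt_half
  -- `2σ³ < η₁/2`, since `σ³ ≤ σ < η₁/4` for `σ < 1`
  have hσ3 : 2 * σ ^ 3 < η₁ / 2 := by
    have h2 : σ ^ 2 ≤ 1 := by nlinarith
    have h3 : σ ^ 3 ≤ σ := by nlinarith
    linarith
  obtain ⟨hsm, hφ0, hφ1, hsupp, hφC, hgrad⟩ := hadm
  have hC : 0 ≤ C := by
    have h0 := hgrad 0 0
    simp only [Nat.cast_zero, zero_add, Real.one_rpow, mul_one] at h0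
    exact (norm_nonneg _).trans h0
  -- fixed-point packing bound at level `η₁/2`, energy cap
  obtain ⟨δ, hδ, hfix⟩ := ceilingFixed_homogeneous_level (η := η₁ / 2) hS hθ hσ3 Φ hγ (by linarith)
    ⟨hsm, hφ0, hφ1, hsupp, hφC, hgrad⟩
  obtain ⟨K, hK, hcap⟩ := hcapσ σ hσ hσb' Φ
  -- the rescaled kernel `φ' = φ/η₁`
  obtain ⟨φ', hφ'⟩ : ∃ φ' : ℕ → T3 → ℝ, ∀ N y, φ' N y = η₁⁻¹ * φ N y := ⟨fun N y => η₁⁻¹ * φ N y, fun _ _ => rfl⟩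
  have hresc : ∀ (N : ℕ) (w : Config (N + 1) (Fin 3) T3) (x : T3),
      empiricalDensityField w (fun y => φ' N (y - x)) = η₁⁻¹ * empiricalDensityField w (fun y => φ N (y - x)) := by
    intro N w x
    simp only [hφ']
    exact empiricalDensityField_const_mul w η₁⁻¹ (fun y => φ N (y - x))
  have hη0 : 0 ≤ η₁⁻¹ := (inv_pos.2 hη₁).le
  -- space–time modulus of the rescaled block density on capped good orbits
  have hmod : ∀ (N : ℕ), ∀ z ∈ (Φ N).good, configEnergy z ≤ K * ((N : ℝ) + 1) →
      ∀ (s s' : ℝ) (x x' : T3),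
        |empiricalDensityField ((Φ N).flow s z) (fun y => φ' N (y - x)) -
            empiricalDensityField ((Φ N).flow s' z) (fun y => φ' N (y - x'))| ≤
          Real.sqrt 3 * (η₁⁻¹ * C * ((N : ℝ) + 1) ^ (4 * γ)) * (‖x - x'‖ + |s - s'| * Real.sqrt (2 * K)) := by
    intro N z hz hE s s' x x'
    have h := stub_blockModulus σ N (Φ N) (φ N) (C * ((N : ℝ) + 1) ^ (4 * γ)) K (hsm N) (hgrad N) hK z hz hE
      s s' x x'
    rw [hresc, hresc, ← mul_sub, abs_mul, abs_of_nonneg hη0]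
    calc η₁⁻¹ * |empiricalDensityField ((Φ N).flow s z) (fun y => φ N (y - x)) -
          empiricalDensityField ((Φ N).flow s' z) (fun y => φ N (y - x'))|
        ≤ η₁⁻¹ * (Real.sqrt 3 * (C * ((N : ℝ) + 1) ^ (4 * γ)) * (‖x - x'‖ + |s - s'| * Real.sqrt (2 * K))) :=
          mul_le_mul_of_nonneg_left h hη0
      _ = Real.sqrt 3 * (η₁⁻¹ * C * ((N : ℝ) + 1) ^ (4 * γ)) * (‖x - x'‖ + |s - s'| * Real.sqrt (2 * K)) := by
          ring
  -- the fixed-point bound for `φ'` at level `1/2` is the one for `φ` at level `η₁/2`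
  have hfix' : ∀ (N : ℕ), ∀ s ∈ Icc 0 t, ∀ x : T3,
      localGibbsLaw σ (fun _ => 1) (fun _ => 0) (fun _ => θ) N (Φ N)
          {z | 1 / 2 < empiricalDensityField ((Φ N).flow s z) (fun y => φ' N (y - x)) * σ ^ 3} ≤
        ENNReal.ofReal (δ N) := by
    intro N s _ x
    have hset : {z : Config (N + 1) (Fin 3) T3 |
          1 / 2 < empiricalDensityField ((Φ N).flow s z) (fun y => φ' N (y - x)) * σ ^ 3} =
        {z | η₁ / 2 < empiricalDensityField ((Φ N).flow s z) (fun y => φ N (y - x)) * σ ^ 3} := by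
      ext z
      simp only [Set.mem_setOf_eq, hresc]
      rw [mul_assoc, inv_mul_eq_div, lt_div_iff₀ hη₁]
      constructor <;> intro h <;> linarith
    rw [hset]
    exact hfix N s x
  -- the chain for `φ'`
  have hchain := ceilingChain σ Φ (fun N => localGibbsLaw σ (fun _ => 1) (fun _ => 0) (fun _ => θ) N (Φ N))
    φ' γ (η₁⁻¹ * C) t K δ hγ hγ' (mul_nonneg hη0 hC) ht hK hσ.le hmod hcap hδ hfix'
  -- back to `φ` at level `η₁`
  have hset : ∀ N : ℕ, {z : Config (N + 1) (Fin 3) T3 | ∃ s ∈ Icc 0 t, ∃ x : T3,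
        η₁ < rhoB φ N ((Φ N).flow s z) x * σ ^ 3} =
      {z | ∃ s ∈ Icc 0 t, ∃ x : T3,
        1 < empiricalDensityField ((Φ N).flow s z) (fun y => φ' N (y - x)) * σ ^ 3} := by
    intro N
    ext z
    simp only [Set.mem_setOf_eq, rhoB, hresc]
    refine exists_congr fun s => and_congr_right fun _ => exists_congr fun x => ?_
    rw [mul_assoc, inv_mul_eq_div, lt_div_iff₀ hη₁, one_mul]
  show Tendsto (fun N : ℕ => localGibbsLaw σ (fun _ => 1) (fun _ => 0) (fun _ => θ) N (Φ N)
    {z | ∃ s ∈ Icc 0 t, ∃ x : T3, η₁ < rhoB φ N ((Φ N).flow s z) x * σ ^ 3}) atTop (𝓝 0)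
  refine hchain.congr fun N => ?_
  rw [hset N]

end Summit.AtomisticToContinuum.HydrodynamicLimit.Theorems.HemisphereAffineSlaving

end
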